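import Summits.QuantumFields.YangMills.Theorems.LuscherReductionTwistedTraceScalingBTFixedBeta
import Summits.QuantumFields.YangMills.Theorems.LuscherReductionTwistedTraceScalingBTColourFP
import Summits.QuantumFields.YangMills.Theorems.LuscherReductionTwistedTraceScalingBOCapProfile
import Summits.QuantumFields.YangMills.Theorems.LuscherReductionTwistedTraceScalingBTFibreProfile
import Summits.QuantumFields.YangMills.Theorems.LuscherReductionTwistedTraceScalingBTSchedule
import Summits.QuantumFields.YangMills.Theorems.FemtoTransferGapBounds
import HarnessLib

/-!
# R65 — the (B-ST) record currency has NO normalisation slack: `btC·K₁(1,1) = fpZ·𝒦_β(1,1) − (FP tail cut)`, hence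
# `Λ_rec ≤ (λ₀/K₁(1,1))·𝒦_β(1,1)/γ` — the target constant of `hST` is at most the `u = 1` Born–Oppenheimer Rayleigh numerator
# (crux disprover of `TwistedTraceScaling`, stmt-QuantumFields-20203, cycle 53; `--supports` the crux; negative lane, def-free)

The (B-ST) hypothesis `hST` of ✓`…BORecordInputOfST.recordAnalyticInput_of_hST` bounds the tube form of every admissible `v` that is fibrewise orthogonal to the record
profile `Ω_c` by `(1 − θ₀)·Λ_rec·‖v‖²_w`, with the RECORD CURRENCY
`Λ_rec(β) = (btC L β Ω_c (btEps β) R₁ / fpZ (btEps β) / recordGamma L Ω_c β) · levelValue su2Rep 1 (L³β) 0`, `btC = fpBOKernel β Ω_c (coreWeight ε R₁) 1 1 / K₁^{(L³β)}(1,1)`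
(✓`…BTFixedBeta`).  Lane A's Poincaré line for `hST` (pub `ym-luscher-20007-p1/Lines-BST-poincare.md`, §(F) = stub (L-6) of `HANDOFF-g21.md`) must, at the end, compare the fibre
Rayleigh quotient of `Ω_c` under the (based / fully) gauge-averaged kernel at the vacuum slow datum with this FP-localised constant «to `1 + o(1)`» — the disprover's watch item of
UPDATE 22b: a fixed factor `≠ 1` between the two normalisations would make `hST` false for EVERY `θ₀ > 0`.
This file settles that question from the definitions, in the negative-knowledge direction useful to both sides:
* §1 ★ `fpBOKernel_fpWeight_one_one` — **at the vacuum slow datum the Faddeev–Popov localisation is exact for every radius `ε`**: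
  `fpBOKernel β Ω (fpWeight ε) 1 1 = fpZ ε · boKernel β Ω 1 1` for colour-blind bounded measurable `Ω` (✓`…BTColourFP.boKernel_fp` at `u = u' = 1`, where the colour integrand
  is constant because a constant conjugation fixes `1`, R33 ✓`Negative/AvgKernelStiffFlip.gaugeTransform_const_oneSite_one`); ★ `btC_mul_oneSite_add_tail` — the exact split
  `btC·K₁(1,1) + fpBOKernel β Ω (tailWeight ε R₁) 1 1 = fpZ ε · boKernel β Ω 1 1` (`fpWeight = coreWeight + tailWeight`, ✓`…BTCoreWeight.fpBOKernel_fpWeight_split`);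
  ★ `btC_mul_oneSite_le`, `btC_div_fpZ_le` — for `Ω ≥ 0` the only deficit is the NONNEGATIVE FP tail cut: `btC/fpZ ≤ boKernel(1,1)/K₁(1,1)`.
* §2 ★★ `recordCurrency_le_boRayleigh` — for the literal record data of `hST` (cap-restricted frozen profile, `ε = btEps β`, `R₁ = 5β^{-1/2}btLog²β`), for EVERY `β`:
  `Λ_rec(β) ≤ (boKernel β Ω_c 1 1 / K₁^{(L³β)}(1,1) / recordGamma L Ω_c β) · levelValue su2Rep 1 (L³β) 0`.
READING.  `boKernel β Ω 1 1 = ∫∫ Ω(v̂) K̃_β(orthoTube 1 v, orthoTube 1 v') Ω(v̂') dπ dπ'` is the fibre form of the FULLY gauge-averaged kernel at `u = u' = 1` (and equals the based-averaged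
form `⟨Θ, G_β Θ⟩` of lane A's `M`, by ✓`…AvgKernelColourBased.avgKernel_eq_colour_based` and the `Ad`-invariance of `Ω_c dπ` — not formalised here), `γ ≈ ‖Θ‖²_w` by the fibre-mass
brick, and `λ₀/K₁(1,1)` is the slow factor: so §2 says the target constant of `hST` is AT MOST the Born–Oppenheimer product Rayleigh quotient of the ground profile itself, with NO
multiplicative room — `hST` is a genuine relative spectral-gap statement on the fibrewise orthocomplement of `Ω_c` (the concrete record-currency form of what R60 `StiffGapCeiling`,
R61 `TensorGapCeiling`, R61B `BOStiffBlockCeiling`, R62 `BOStiffDoorGainCeiling` assume abstractly: every `θ₀` must be paid by a true fibre gap; any multiplicative loss in the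
transport (C), the fibre gap (D), (E) beyond `θ_door` is fatal), and conversely lane A's (L-6) holds with deficit = the FP core cut `fpBOKernel(tailWeight)(1,1)/fpZ` ONLY (no
`1 + o(1)` matching of two different normalisations is needed — they coincide identically).
HONEST FRAMING: finite-lattice bookkeeping identities for a stub (S-BASE, (B-ST)) of a child of the CONDITIONAL reduction route R2b1; no kernel estimate refuted or proved;
(B-ST) OPEN; C4 OPEN; not infinite volume, not a gap, not Clay.

## References
* M. Lüscher, Some analytic results concerning the mass spectrum of Yang–Mills gauge theories on a torus, Nucl. Phys. B219 (1983) 233–261, §3 (collective-coordinate /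
  Faddeev–Popov treatment of the constant gauge modes). [Luscher1983]
* E. Seiler, Gauge Theories as a Problem of Constructive Quantum Field Theory and Statistical Mechanics, LNP 159 (1982), §3 (transfer matrix, gauge averaging). [SeilerLNP1982]
-/

set_option autoImplicit false

noncomputable section

open Real MeasureTheory Filter Topology
open scoped BigOperators
open Literature.MathematicalPhysics.QuantumFieldTheory hiding SU2
open Literature.MathematicalPhysics.QuantumLattice

namespace Summit.QuantumFields.YangMills.Theorems.TwistedTraceScaling.Negative.R65

open Summit.QuantumFields.YangMills.Theorems.FemtoTransferGap
open Summit.QuantumFields.YangMills.Theorems.FemtoTransferGap.TwoLattice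
open Summit.QuantumFields.YangMills.Theorems.FemtoTransferGap.TwoLattice.Avg
open Summit.QuantumFields.YangMills.Theorems.FemtoTransferGap.TwoLattice.ConstTube
open Summit.QuantumFields.YangMills.Theorems.FemtoTransferGap.TwoLattice.Stiff (LinkSpace)
open Summit.QuantumFields.YangMills.Theorems.FemtoTransferGap.TwoLattice.GnChart (linkCurry)
open Summit.QuantumFields.YangMills.Theorems.TwistedTraceScaling.Negative (R33.gaugeTransform_const_oneSite_one)

variable {L : ℕ} [NeZero L]

/-! ## §1 FP localisation is exact at the vacuum slow datum; the exact core/tail split of `btC` -/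

/-- ★ **FP localisation is exact at `u = u' = 1`**: `fpBOKernel β Ω (fpWeight ε) 1 1 = fpZ ε · boKernel β Ω 1 1` for colour-blind bounded measurable `Ω`, every `ε`. [cite: Luscher1983, §3] -/
theorem fpBOKernel_fpWeight_one_one (β ε : ℝ) {Ω : LinkSpace L → ℝ} (hΩm : Measurable Ω) {CΩ : ℝ} (hCΩ : ∀ x, |Ω x| ≤ CΩ)
    (hΩinv : ∀ (g : SU2) (x : LinkSpace L), Ω (adL L g x) = Ω x) :
    fpBOKernel L β Ω (fpWeight L ε) 1 1 = fpZ ε * boKernel L β Ω 1 1 := by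
  obtain ⟨-, h⟩ := boKernel_fp (L := L) β hΩm hCΩ hΩinv (measurable_fpWeight L ε) (abs_fpWeight_le (L := L) ε) (fpWeight_orbit (L := L) ε) 1 1
  rw [h]
  simp only [R33.gaugeTransform_const_oneSite_one, integral_const, smul_eq_mul, probReal_univ, one_mul]

/-- ★ **The exact core/tail split of the (B-T) constant**: `btC·K₁(1,1) + fpBOKernel β Ω (tailWeight ε R₁) 1 1 = fpZ ε · boKernel β Ω 1 1`. [cite: Luscher1983, §3] -/
theorem btC_mul_oneSite_add_tail (β ε R₁ : ℝ) {Ω : LinkSpace L → ℝ} (hΩm : Measurable Ω) {CΩ : ℝ} (hCΩ : ∀ x, |Ω x| ≤ CΩ)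
    (hΩinv : ∀ (g : SU2) (x : LinkSpace L), Ω (adL L g x) = Ω x) :
    btC L β Ω ε R₁ * transferKernel su2Rep ((L : ℝ) ^ 3 * β) (1 : GaugeConfig 3 1 SU2) 1 + fpBOKernel L β Ω (tailWeight L ε R₁) 1 1 =
      fpZ ε * boKernel L β Ω 1 1 := by
  unfold btC
  rw [div_mul_cancel₀ _ (transferKernel_pos su2Rep ((L : ℝ) ^ 3 * β) (1 : GaugeConfig 3 1 SU2) 1).ne',
    ← fpBOKernel_fpWeight_split β ε R₁ hΩm hCΩ 1 1, fpBOKernel_fpWeight_one_one β ε hΩm hCΩ hΩinv]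

/-- ★ For `Ω ≥ 0` the FP tail cut is nonnegative: `btC·K₁(1,1) ≤ fpZ ε · boKernel β Ω 1 1`. [cite: Luscher1983, §3] -/
theorem btC_mul_oneSite_le (β ε R₁ : ℝ) {Ω : LinkSpace L → ℝ} (hΩm : Measurable Ω) {CΩ : ℝ} (hCΩ : ∀ x, |Ω x| ≤ CΩ) (hΩ0 : ∀ x, 0 ≤ Ω x)
    (hΩinv : ∀ (g : SU2) (x : LinkSpace L), Ω (adL L g x) = Ω x) :
    btC L β Ω ε R₁ * transferKernel su2Rep ((L : ℝ) ^ 3 * β) (1 : GaugeConfig 3 1 SU2) 1 ≤ fpZ ε * boKernel L β Ω 1 1 := by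
  rw [← btC_mul_oneSite_add_tail β ε R₁ hΩm hCΩ hΩinv]
  exact le_add_of_nonneg_right (fpBOKernel_nonneg β hΩm hCΩ hΩ0 (measurable_tailWeight ε R₁) (abs_tailWeight_le ε R₁) (fun g => (tailWeight_mem_Icc ε R₁ g).1) 1 1)

/-- ★ **No normalisation slack**: `btC/fpZ ≤ boKernel(1,1)/K₁(1,1)` (`ε > 0`, `Ω ≥ 0` colour blind). [cite: Luscher1983, §3] -/
theorem btC_div_fpZ_le (β : ℝ) {ε : ℝ} (hε : 0 < ε) (R₁ : ℝ) {Ω : LinkSpace L → ℝ} (hΩm : Measurable Ω) {CΩ : ℝ} (hCΩ : ∀ x, |Ω x| ≤ CΩ) (hΩ0 : ∀ x, 0 ≤ Ω x)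
    (hΩinv : ∀ (g : SU2) (x : LinkSpace L), Ω (adL L g x) = Ω x) :
    btC L β Ω ε R₁ / fpZ ε ≤ boKernel L β Ω 1 1 / transferKernel su2Rep ((L : ℝ) ^ 3 * β) (1 : GaugeConfig 3 1 SU2) 1 := by
  have hK := transferKernel_pos su2Rep ((L : ℝ) ^ 3 * β) (1 : GaugeConfig 3 1 SU2) 1
  have hZ := fpZ_pos hε
  rw [div_le_div_iff₀ hZ hK, mul_comm (boKernel L β Ω 1 1)]
  exact btC_mul_oneSite_le β ε R₁ hΩm hCΩ hΩ0 hΩinv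

/-- The tail cut is the WHOLE deficit: `boKernel(1,1)/K₁(1,1) − btC/fpZ = fpBOKernel(tailWeight)(1,1)/(fpZ·K₁(1,1))`. [cite: Luscher1983, §3] -/
theorem boRayleigh_sub_btC_div_fpZ (β : ℝ) {ε : ℝ} (hε : 0 < ε) (R₁ : ℝ) {Ω : LinkSpace L → ℝ} (hΩm : Measurable Ω) {CΩ : ℝ} (hCΩ : ∀ x, |Ω x| ≤ CΩ)
    (hΩinv : ∀ (g : SU2) (x : LinkSpace L), Ω (adL L g x) = Ω x) :
    boKernel L β Ω 1 1 / transferKernel su2Rep ((L : ℝ) ^ 3 * β) (1 : GaugeConfig 3 1 SU2) 1 - btC L β Ω ε R₁ / fpZ ε =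
      fpBOKernel L β Ω (tailWeight L ε R₁) 1 1 / (fpZ ε * transferKernel su2Rep ((L : ℝ) ^ 3 * β) (1 : GaugeConfig 3 1 SU2) 1) := by
  have hK := transferKernel_pos su2Rep ((L : ℝ) ^ 3 * β) (1 : GaugeConfig 3 1 SU2) 1
  have hZ := fpZ_pos hε
  have h := btC_mul_oneSite_add_tail β ε R₁ hΩm hCΩ hΩinv
  rw [div_sub_div _ _ hK.ne' hZ.ne', div_eq_div_iff (mul_ne_zero hK.ne' hZ.ne') (mul_ne_zero hZ.ne' hK.ne')]
  linear_combination (-(fpZ ε * transferKernel su2Rep ((L : ℝ) ^ 3 * β) (1 : GaugeConfig 3 1 SU2) 1)) * h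

/-! ## §2 The record currency of `hST` is at most the `u = 1` BO Rayleigh numerator over `γ` -/

set_option maxHeartbeats 800000 in
-- long record expressions.
/-- ★★ **`Λ_rec ≤ (𝒦_β(1,1)/K₁(1,1)/γ)·λ₀(L³β)`** for the literal record data of `hST` (every `β`): the (B-ST) target constant carries no normalisation slack. [cite: Luscher1983, §3] -/
theorem recordCurrency_le_boRayleigh (β : ℝ) :
    btC L β (fun x : LinkSpace L => {x : LinkSpace L | linkCurry x ∈ capBalancedSet L}.indicator (fun _ => (1 : ℝ)) x *
          frozenProfile L (fun β' => stiffGaussExp L (β' / 2) β') (fun β' => min (1 / 40) (powScale (1 / 2) β' * btLog β')) β x)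
        (btEps β) (5 * (powScale (1 / 2) β * btLog β ^ 2)) / fpZ (btEps β) /
        recordGamma L (fun β' => fun x : LinkSpace L => {x : LinkSpace L | linkCurry x ∈ capBalancedSet L}.indicator (fun _ => (1 : ℝ)) x *
          frozenProfile L (fun β'' => stiffGaussExp L (β'' / 2) β'') (fun β'' => min (1 / 40) (powScale (1 / 2) β'' * btLog β'')) β' x) β *
        levelValue su2Rep 1 ((L : ℝ) ^ 3 * β) 0 ≤
      boKernel L β (fun x : LinkSpace L => {x : LinkSpace L | linkCurry x ∈ capBalancedSet L}.indicator (fun _ => (1 : ℝ)) x *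
          frozenProfile L (fun β' => stiffGaussExp L (β' / 2) β') (fun β' => min (1 / 40) (powScale (1 / 2) β' * btLog β')) β x) 1 1 /
        transferKernel su2Rep ((L : ℝ) ^ 3 * β) (1 : GaugeConfig 3 1 SU2) 1 /
        recordGamma L (fun β' => fun x : LinkSpace L => {x : LinkSpace L | linkCurry x ∈ capBalancedSet L}.indicator (fun _ => (1 : ℝ)) x *
          frozenProfile L (fun β'' => stiffGaussExp L (β'' / 2) β'') (fun β'' => min (1 / 40) (powScale (1 / 2) β'' * btLog β'')) β' x) β *
        levelValue su2Rep 1 ((L : ℝ) ^ 3 * β) 0 := by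
  -- structural fields of the cap-restricted frozen profile at `β`
  have hqfm : Measurable ((fun β' => stiffGaussExp L (β' / 2) β') β) := measurable_stiffGaussExp _ _
  have hqf0 : ∀ β' x, 0 ≤ (fun β' => stiffGaussExp L (β' / 2) β') β' x := fun β' x => stiffGaussExp_nonneg _ _ x
  have hqinv : ∀ β' (g : SU2) (x : LinkSpace L), (fun β' => stiffGaussExp L (β' / 2) β') β' (adL L g x) = (fun β' => stiffGaussExp L (β' / 2) β') β' x :=
    fun β' g x => stiffGaussExp_adL _ _ g x
  have hFm : Measurable (frozenProfile L (fun β' => stiffGaussExp L (β' / 2) β') (fun β' => min (1 / 40) (powScale (1 / 2) β' * btLog β')) β) :=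
    measurable_frozenProfile (fun β' => measurable_stiffGaussExp _ _) _ β
  have hF1 : ∀ x, |frozenProfile L (fun β' => stiffGaussExp L (β' / 2) β') (fun β' => min (1 / 40) (powScale (1 / 2) β' * btLog β')) β x| ≤ 1 :=
    abs_frozenProfile_le hqf0 _ β
  have hF0 : ∀ x, 0 ≤ frozenProfile L (fun β' => stiffGaussExp L (β' / 2) β') (fun β' => min (1 / 40) (powScale (1 / 2) β' * btLog β')) β x :=
    fun x => (frozenProfile_mem_Icc hqf0 _ β x).1
  have hΩm : Measurable (fun x : LinkSpace L => {x : LinkSpace L | linkCurry x ∈ capBalancedSet L}.indicator (fun _ => (1 : ℝ)) x *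
      frozenProfile L (fun β' => stiffGaussExp L (β' / 2) β') (fun β' => min (1 / 40) (powScale (1 / 2) β' * btLog β')) β x) :=
    measurable_capRestrict (L := L) hFm
  have hΩ1 : ∀ x, |{x : LinkSpace L | linkCurry x ∈ capBalancedSet L}.indicator (fun _ => (1 : ℝ)) x *
      frozenProfile L (fun β' => stiffGaussExp L (β' / 2) β') (fun β' => min (1 / 40) (powScale (1 / 2) β' * btLog β')) β x| ≤ 1 :=
    fun x => (capRestrict_mem (L := L) hF0 hF1 x).2.2
  have hΩ0 : ∀ x, 0 ≤ {x : LinkSpace L | linkCurry x ∈ capBalancedSet L}.indicator (fun _ => (1 : ℝ)) x *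
      frozenProfile L (fun β' => stiffGaussExp L (β' / 2) β') (fun β' => min (1 / 40) (powScale (1 / 2) β' * btLog β')) β x :=
    fun x => (capRestrict_mem (L := L) hF0 hF1 x).1
  have hΩinv : ∀ (g : SU2) (x : LinkSpace L), {x : LinkSpace L | linkCurry x ∈ capBalancedSet L}.indicator (fun _ => (1 : ℝ)) (adL L g x) *
      frozenProfile L (fun β' => stiffGaussExp L (β' / 2) β') (fun β' => min (1 / 40) (powScale (1 / 2) β' * btLog β')) β (adL L g x) =
      {x : LinkSpace L | linkCurry x ∈ capBalancedSet L}.indicator (fun _ => (1 : ℝ)) x *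
      frozenProfile L (fun β' => stiffGaussExp L (β' / 2) β') (fun β' => min (1 / 40) (powScale (1 / 2) β' * btLog β')) β x :=
    fun g x => capRestrict_adL (L := L) (fun g' x' => frozenProfile_adL hqinv _ β g' x') g x
  -- signs of the two scalar factors
  have hγ0 : 0 ≤ recordGamma L (fun β' => fun x : LinkSpace L => {x : LinkSpace L | linkCurry x ∈ capBalancedSet L}.indicator (fun _ => (1 : ℝ)) x *
      frozenProfile L (fun β'' => stiffGaussExp L (β'' / 2) β'') (fun β'' => min (1 / 40) (powScale (1 / 2) β'' * btLog β'')) β' x) β := by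
    unfold recordGamma boGamma
    exact mul_nonneg (fpWeightBar_pos L (powScale_pos 1 β)).le (integral_nonneg fun v => mul_nonneg (sq_nonneg _) (Real.exp_pos _).le)
  have hlam0 : 0 ≤ levelValue su2Rep 1 ((L : ℝ) ^ 3 * β) 0 := (levelValue_zero_su2Rep_pos 1 ((L : ℝ) ^ 3 * β)).le
  have hε : 0 < btEps β := by unfold btEps; exact powScale_pos 1 β
  have key := btC_div_fpZ_le (L := L) β hε (5 * (powScale (1 / 2) β * btLog β ^ 2)) hΩm hΩ1 hΩ0 hΩinv
  exact mul_le_mul_of_nonneg_right (div_le_div_of_nonneg_right key hγ0) hlam0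

end Summit.QuantumFields.YangMills.Theorems.TwistedTraceScaling.Negative.R65

end
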